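import Summits.NavierStokesRegularity.NavierStokesRegularity.Theorems.SymmetricLiouville.Negative.LoadBearing
import Literature.Analysis.UnboundedOperators.HeatExtensionDecay
import Literature.Analysis.FluidPDE.TypeIAncientMild

/-!
# Crux `SymmetricLiouville` (stmt-NavierStokesRegularity-4053), negative side, cycle 2:
the nonlinearity is load-bearing, the symmetry clause is un-witnessable, `IsSkew` shields nothing

Negative-side (cdisprove, D-0016) support lemmas extracted from
`Cruxes/SymmetricLiouville/Disproof.lean` (v7, gen-2 seat, §§(d)–(e)) of route `SymmetryModuliCount`.
All statements are about the clauses `InClass`, `IsSkew`, `HasSymmetry`, `VanishesOnPast` of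
`LoadBearing.lean` (the crux unbundled there by `symmetricLiouville_iff`, `Iff.rfl`).

* `inClass_iff_isTypeIAncientMild` — the class `𝒜_C` of the crux IS the tree's
  `Literature.Analysis.FluidPDE.IsTypeIAncientMild C` (definitional), so its API (time shifts
  `comp_sub_right`, KNSS Rem. 6.1 `eq_zero_of_slice_const`, the duality-form bridge) applies
  verbatim: `InClass.timeShift`, `InClass.vanishes_of_slice_const`.
* `vanishes_of_heatMild_typeI`, `InClass.vanishes_of_duhamel_zero`,
  `InClass.norm_le_div_sqrt_add_norm_duhamel` — **the Navier–Stokes nonlinearity is load-bearing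
  for any counterexample**: a field propagated by the heat semigroup with Type-I time decay is `0`
  (sup-norm contraction + `s → −∞`), so an element of `𝒜_C` whose Oseen–Duhamel term vanishes is
  `0`, and in general `‖u(t,x)‖ ≤ C/√(−s) + ‖∫_s^t∫K[u,u]‖` for every `s < t`: the Duhamel integral
  from the far past must carry ALL of `u`. Every explicit family with vanishing or gradient
  nonlinearity (constants, parallel/shear flows, Beltrami modes) is dead on arrival inside `𝒜_C`,
  with or without symmetry — the linearised crux is trivially TRUE.
* (sibling file `SmallConstantGap.lean`: the gap theorem `sup √(−t)‖u‖ ≤ ε₀ ⇒ u ≡ 0`.)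
* `exists_witness_of_not_symmetricLiouville`, `not_typeIAncientLiouville_of_not_symmetricLiouville`
  — **the symmetry clause cannot be shown load-bearing by example**: any refutation of the crux (or
  of any mutant keeping the four class hypotheses) exhibits a NONZERO element of `𝒜_C`, i.e. a
  nontrivial Type-I ancient mild solution, and refutes the route target `X` outright.
* `vanishes_of_hasSymmetry_id`, `vanishes_of_hasSymmetry_antiscaling` — **`IsSkew` shields nothing**
  in the two simplest non-skew directions: `ξ = (0, 0, 1)` (`(x·∇)u = u`, Euler-homogeneous of
  degree `1`: killed by boundedness of the slice, `eq_zero_of_fderiv_self_of_bounded`) and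
  `ξ = (0, σ, −σ·1)` (`u + t∂ₜu = 0`, `u = U(x)/(−t)`: killed by the Type-I RATE as `t → 0⁻`).

No route statement is changed (`--supports`).
-/

noncomputable section

namespace Summit.NavierStokesRegularity.NavierStokesRegularity.Theorems.SymmetricLiouville.Negative

open Literature.Analysis.FluidPDE MeasureTheory Set Function
open scoped RealInnerProductSpace

open Summit.NavierStokesRegularity.NavierStokesRegularity.Theses.SymmetryModuliCount
  (SymmetricLiouville TypeIAncientLiouville)

local notation "E3" => EuclideanSpace ℝ (Fin 3)


/-- **Bridge (definitional)**: `𝒜_C` of the crux is the tree's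
`Literature.Analysis.FluidPDE.IsTypeIAncientMild C` (`TypeIAncientMild.lean`; `oseenDuhamel 1 s u u t x`
unfolds to the literal double integral of the route). Hence its API applies verbatim: time shifts
into the past (`comp_sub_right`), KNSS Rem. 6.1 (`eq_zero_of_slice_const`), the duality-form bridge
(`isAncientMildSolution`, `isBoundedAncientMildSolution_sub`), classical-solution extraction
(`TypeIAncientMildClassical.lean`). -/
theorem inClass_iff_isTypeIAncientMild {C : ℝ} {u : ℝ → E3 → E3} :
    InClass C u ↔ IsTypeIAncientMild C u := by
  rw [isTypeIAncientMild_iff]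
  rfl

/-- The class is invariant under time shifts into the past (`t ↦ u(t − δ)`, `δ ≥ 0`). (The
time-shifted copy of a scaling-symmetric element carries the generator `x·∇ + 1 + 2(t−δ)∂ₜ`, which is
NOT in the crux's family `sim(3)` anchored at `t = 0` — harmless for 4053, see §(c) SCOPE REMARK.) -/
theorem InClass.timeShift {C : ℝ} {u : ℝ → E3 → E3} (hu : InClass C u) {δ : ℝ} (hδ : 0 ≤ δ) :
    InClass C (fun t => u (t - δ)) :=
  inClass_iff_isTypeIAncientMild.2 ((inClass_iff_isTypeIAncientMild.1 hu).comp_sub_right hδ)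

/-- **No parasitic moduli in `𝒜_C`** (KNSS 2009 Rem. 6.1 + the decay; tree
`IsTypeIAncientMild.eq_zero_of_slice_const`): a slice-wise spatially constant element
`u(t,·) = b(t)` of `𝒜_C` is `0`, with no symmetry hypothesis at all. -/
theorem InClass.vanishes_of_slice_const {C : ℝ} {u : ℝ → E3 → E3} (hu : InClass C u)
    {b : ℝ → E3} (hub : ∀ t < 0, ∀ x, u t x = b t) : VanishesOnPast u :=
  fun _ ht x => (inClass_iff_isTypeIAncientMild.1 hu).eq_zero_of_slice_const hub ht x

/-! ### The linearised crux is trivially true -/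

/-- A vector with `‖v‖ ≤ C/√(−s)` for all `s` below some `t ≤ 0` is zero (`s → −∞`). -/
theorem eq_zero_of_forall_norm_le_div_sqrt {v : E3} {t C : ℝ}
    (h : ∀ s < t, ‖v‖ ≤ C / Real.sqrt (-s)) (ht : t ≤ 0) : v = 0 := by
  by_contra hv
  have hn : 0 < ‖v‖ := norm_pos_iff.2 hv
  set s : ℝ := t - (C / ‖v‖) ^ 2 - 1 with hs
  have hst : s < t := by rw [hs]; nlinarith [sq_nonneg (C / ‖v‖)]
  have hneg : (C / ‖v‖) ^ 2 < -s := by rw [hs]; linarith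
  have hspos : 0 < Real.sqrt (-s) := Real.sqrt_pos.2 (by nlinarith [sq_nonneg (C / ‖v‖)])
  have h1 : |C| / ‖v‖ < Real.sqrt (-s) := by
    rw [← abs_of_pos hn, ← abs_div, ← Real.sqrt_sq_eq_abs]
    exact Real.sqrt_lt_sqrt (sq_nonneg _) hneg
  have h2 : |C| < Real.sqrt (-s) * ‖v‖ := by rwa [div_lt_iff₀ hn] at h1
  have h3 : ‖v‖ * Real.sqrt (-s) ≤ C := (le_div_iff₀ hspos).1 (h s hst)
  linarith [le_abs_self C, mul_comm ‖v‖ (Real.sqrt (-s))]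

/-- **Linear Liouville — the nonlinearity is load-bearing for any counterexample.** A field on
`(−∞,0) × ℝ³` propagated by the heat semigroup between all times `s < t < 0` with the Type-I time
bound vanishes: `‖u(t,x)‖ = ‖e^{(t−s)Δ}u(s)(x)‖ ≤ C/√(−s) → 0` as `s → −∞`
(`norm_heatExtension_le_of_bound`). No smoothness, divergence, measurability or SYMMETRY is used:
at the linear level the crux is true for free, so the would-be counterexample lives entirely in the
large-`C` nonlinear regime (`√(−t)‖u(t)‖_∞ ≤ c·C²` forces `C ≥ 1/c`, the perturbative threshold). -/
theorem vanishes_of_heatMild_typeI {C : ℝ} {u : ℝ → E3 → E3}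
    (hheat : ∀ s t : ℝ, s < t → t < 0 → ∀ x, u t x = heatFlow (u s) (t - s) x)
    (hT : HasTypeITimeDecay C u) : VanishesOnPast u := by
  intro t ht x
  refine eq_zero_of_forall_norm_le_div_sqrt (t := t) (C := C) (fun s hs => ?_) ht.le
  have hσ : 0 < t - s := sub_pos.2 hs
  rw [hheat s t hs ht x, heatFlow_of_pos _ hσ]
  exact Literature.Analysis.UnboundedOperators.norm_heatExtension_le_of_bound
    (fun z => hT s (hs.trans ht) z) hσ x

/-- **An element of `𝒜_C` whose Oseen–Duhamel term vanishes identically is `0`** (no symmetry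
needed). Kills inside `𝒜_C`, in one stroke, every explicit family with vanishing or pure-gradient
nonlinearity: constants, parallel / shear flows (`shearWave`), Beltrami–Trkalian modes `e^{−λ²t}U`
(`(U·∇)U = ∇|U|²/2`), all of which are exact Navier–Stokes solutions. -/
theorem InClass.vanishes_of_duhamel_zero {C : ℝ} {u : ℝ → E3 → E3} (hu : InClass C u)
    (hD : ∀ s t : ℝ, s < t → t < 0 → ∀ x,
      ∫ τ in Set.Ioo s t, ∫ y, oseenKernel (t - τ) (x - y) (u τ y) (u τ y) = 0) :
    VanishesOnPast u := by
  refine vanishes_of_heatMild_typeI (C := C) (fun s t hst ht x => ?_) hu.2.2.2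
  rw [hu.2.2.1 s t hst ht x, hD s t hst ht x, sub_zero]

/-- **The Duhamel integral from the far past carries all of `u`**: for `u ∈ 𝒜_C` and `s < t < 0`,
`‖u(t,x)‖ ≤ C/√(−s) + ‖∫_s^t ∫ K(t−τ, x−y)[u(τ,y), u(τ,y)] dy dτ‖`, the first term being `o(1)` as
`s → −∞`. With Koch–Tataru's bound (14) the second term is `≤ c ∫_s^t (t−τ)^{-1/2} C²/(−τ) dτ ≤ cπC²/√(−t)`:
the crux is trivially true for `C < 1/(cπ)` and any counterexample saturates this balance. -/
theorem InClass.norm_le_div_sqrt_add_norm_duhamel {C : ℝ} {u : ℝ → E3 → E3} (hu : InClass C u)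
    {s t : ℝ} (hst : s < t) (ht : t < 0) (x : E3) :
    ‖u t x‖ ≤ C / Real.sqrt (-s) +
      ‖∫ τ in Set.Ioo s t, ∫ y, oseenKernel (t - τ) (x - y) (u τ y) (u τ y)‖ := by
  have hσ : 0 < t - s := sub_pos.2 hst
  rw [hu.2.2.1 s t hst ht x, heatFlow_of_pos _ hσ]
  exact (norm_sub_le _ _).trans (add_le_add
    (Literature.Analysis.UnboundedOperators.norm_heatExtension_le_of_bound
      (fun z => hu.2.2.2 s (hst.trans ht) z) hσ x) le_rfl)

/-! ### The symmetry clause is un-witnessable: every kill exhibits `𝒜_C ∖ {0} ≠ ∅` -/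

/-- **Any refutation of the crux produces a nonzero Type-I ancient mild solution** carrying a
nonzero infinitesimal similarity symmetry (unfolding the negation through `symmetricLiouville_iff`).
Since the only known element of `𝒜_C` is `0` — a nonzero one is (the profile of) a Type-I
singularity — NO mutation of the symmetry clause (dropping `IsSkew`, dropping the non-triviality of
`ξ`, assuming the symmetry on a window only, …) can be shown load-bearing by an example: every such
witness is a nonzero element of `𝒜_C`. Only the four CLASS hypotheses admit mutation witnesses
(§(a), §(a′)). -/
theorem exists_witness_of_not_symmetricLiouville (h : ¬ SymmetricLiouville) :
    ∃ (C : ℝ) (u : ℝ → E3 → E3), InClass C u ∧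
      (∃ (a : E3) (σ : ℝ) (A : E3 →L[ℝ] E3), IsSkew A ∧ ¬ (a = 0 ∧ σ = 0 ∧ A = 0) ∧
        HasSymmetry u a σ A) ∧ ∃ t < 0, ∃ x, u t x ≠ 0 := by
  by_contra hcon
  apply h
  rw [symmetricLiouville_iff]
  intro C u hu a σ A hA hne hsym t ht x
  by_contra hx
  exact hcon ⟨C, u, hu, ⟨a, σ, A, hA, hne, hsym⟩, t, ht, x, hx⟩

/-- **A kill of the crux kills the route target `X`** (the crux is a weakening of
`X = TypeIAncientLiouville`; contrapositive): the disprover's only possible product is a nonzero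
Type-I ancient mild solution, i.e. (Seregin–Šverák 2009, Albritton–Barker 2019) a Type-I singularity
of Navier–Stokes — here one with a continuous similarity symmetry. -/
theorem not_typeIAncientLiouville_of_not_symmetricLiouville (h : ¬ SymmetricLiouville) :
    ¬ TypeIAncientLiouville :=
  fun hX => h (fun C u hu _ _ _ _ _ _ => hX C u hu)

/-! ## (e) `IsSkew` shields nothing: the two simplest non-skew generators are harmless

The previous cycle conjectured that `IsSkew` is unnecessary. Two kernel-checked instances: the
pure dilation `A = 1` (killed by BOUNDEDNESS of a slice — Euler's homogeneous-function theorem) and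
the anti-scaling `ξ = (0, σ, −σ·1)` (killed by the Type-I RATE at `t → 0⁻`). The remaining non-skew
directions reduce on paper to the same mechanisms (an eigenvalue with nonzero real part ⇒
boundedness along the expanding/contracting orbit; nilpotent ⇒ shear-invariance ⇒ 2.5-D ⇒ leaf (T)),
except the "elliptic rotations" (semisimple, spectrum `{0, ±iω}`, non-normal), for which no
reduction and no example is known — but by §(d) no example can exist short of a nonzero element of
`𝒜_C` anyway. -/

/-- **Euler's theorem, bounded case**: a differentiable field with `Du(x)·x = u(x)` for all `x`
(homogeneous of degree one) which is bounded vanishes identically: `s ↦ e^{−s}u(e^{s}x)` has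
derivative `0`, so `‖u(x)‖ e^{s} = ‖u(e^{s}x)‖ ≤ M` for every `s`. -/
theorem eq_zero_of_fderiv_self_of_bounded {v : E3 → E3} (hv : Differentiable ℝ v)
    (hE : ∀ x, fderiv ℝ v x x = v x) {M : ℝ} (hM : ∀ x, ‖v x‖ ≤ M) (x : E3) : v x = 0 := by
  set g : ℝ → E3 := fun s => Real.exp (-s) • v (Real.exp s • x) with hg
  have hderiv : ∀ s, HasDerivAt g 0 s := by
    intro s
    have h1 : HasDerivAt (fun r => Real.exp r • x) (Real.exp s • x) s :=
      (Real.hasDerivAt_exp s).smul_const x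
    have h2 : HasDerivAt (fun r => v (Real.exp r • x))
        (fderiv ℝ v (Real.exp s • x) (Real.exp s • x)) s :=
      (hv (Real.exp s • x)).hasFDerivAt.comp_hasDerivAt s h1
    rw [hE] at h2
    have h3 : HasDerivAt (fun r => Real.exp (-r)) (-Real.exp (-s)) s := by
      have h := ((hasDerivAt_id s).neg).exp
      simp only [mul_neg, mul_one] at h
      exact h
    have h4 : HasDerivAt g
        (Real.exp (-s) • v (Real.exp s • x) + (-Real.exp (-s)) • v (Real.exp s • x)) s :=
      h3.fun_smul h2
    have hz : Real.exp (-s) • v (Real.exp s • x) + (-Real.exp (-s)) • v (Real.exp s • x) = 0 := by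
      rw [neg_smul, add_neg_cancel]
    rwa [hz] at h4
  have hconst : ∀ s, g s = g 0 := fun s =>
    is_const_of_deriv_eq_zero (fun s => (hderiv s).differentiableAt) (fun s => (hderiv s).deriv) s 0
  have hg0 : g 0 = v x := by simp [hg]
  have hbound : ∀ s : ℝ, ‖v x‖ * Real.exp s ≤ M := by
    intro s
    have h := hconst s
    rw [hg0] at h
    simp only [hg] at h
    rw [← h, norm_smul, Real.norm_eq_abs, abs_of_pos (Real.exp_pos _), mul_comm,
      ← mul_assoc, ← Real.exp_add, add_neg_cancel, Real.exp_zero, one_mul]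
    exact hM _
  by_contra hx
  have hn : 0 < ‖v x‖ := norm_pos_iff.2 hx
  have h1 := hbound (M / ‖v x‖)
  have h2 : M / ‖v x‖ + 1 ≤ Real.exp (M / ‖v x‖) := Real.add_one_le_exp _
  have h3 : ‖v x‖ * (M / ‖v x‖ + 1) ≤ M := (mul_le_mul_of_nonneg_left h2 hn.le).trans h1
  rw [mul_add, mul_div_cancel₀ _ hn.ne', mul_one] at h3
  linarith

/-- **`IsSkew` shields nothing in the direction `A = 1`** (`ξ = (0, 0, 1)`, NOT skew): the symmetry
clause reads `(x·∇)u = u` on every slice; a slice of an element of `𝒜_C` is smooth and bounded by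
`C/√(−t)`, hence `0` by Euler's theorem. The non-skew mutant of the crux HOLDS at this `ξ`. -/
theorem vanishes_of_hasSymmetry_id {C : ℝ} {u : ℝ → E3 → E3} (hu : InClass C u)
    (h : HasSymmetry u 0 0 (ContinuousLinearMap.id ℝ E3)) : VanishesOnPast u := by
  intro t ht x
  have hcl := inClass_iff_isTypeIAncientMild.1 hu
  have hdiff : Differentiable ℝ (u t) := (hcl.contDiff_slice ht).differentiable (by simp)
  have hE : ∀ y, fderiv ℝ (u t) y y = u t y := by
    intro y
    have := h t ht y
    simp only [zero_smul, zero_add, ContinuousLinearMap.id_apply, mul_zero, zero_mul,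
      add_zero, sub_eq_zero] at this
    exact this
  exact eq_zero_of_fderiv_self_of_bounded hdiff hE (fun y => hcl.norm_le ht y) x

/-- **`IsSkew` shields nothing in the direction `A = −σ·1`** (`ξ = (0, σ, −σ·1)`, `σ ≠ 0`, NOT skew):
the spatial parts cancel and the clause reads `2σ(u + t∂ₜu) = 0`, so `t ↦ t·u(t,x)` is constant on
`(−∞,0)`, `u(t,x) = U(x)/(−t)`; the Type-I RATE near `t = 0⁻` gives `‖U(x)‖ ≤ C√(−t') → 0`.
Dually to `FinerCuts.lean` (decay at `−∞`), here it is the rate at `0⁻` that is used. -/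
theorem vanishes_of_hasSymmetry_antiscaling {C : ℝ} {u : ℝ → E3 → E3} (hu : InClass C u)
    {σ : ℝ} (hσ : σ ≠ 0) (h : HasSymmetry u 0 σ (-(σ • ContinuousLinearMap.id ℝ E3))) :
    VanishesOnPast u := by
  have hcl := inClass_iff_isTypeIAncientMild.1 hu
  have hC : 0 ≤ C := hcl.nonneg
  intro t ht x
  set f : ℝ → E3 := fun r => u r x with hf
  have hfd : ∀ r < 0, DifferentiableAt ℝ f r := by
    intro r hr
    have h1 : ContDiffAt ℝ (⊤ : ℕ∞) (Function.uncurry u) (r, x) :=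
      hu.1.contDiffAt ((isOpen_Iio.prod isOpen_univ).mem_nhds ⟨hr, Set.mem_univ _⟩)
    have h2 : ContDiffAt ℝ (⊤ : ℕ∞) (fun r' : ℝ => (r', x)) r :=
      (contDiff_id.prodMk contDiff_const).contDiffAt
    exact (h1.comp r h2).differentiableAt (by simp)
  have hode : ∀ r < 0, f r + r • deriv f r = 0 := by
    intro r hr
    have key := h r hr x
    have hsp : (0 : E3) + σ • x + (-(σ • ContinuousLinearMap.id ℝ E3)) x = 0 := by simp
    rw [hsp, map_zero, zero_add] at key
    have e : (-(σ • ContinuousLinearMap.id ℝ E3)) (u r x) = -(σ • u r x) := rfl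
    rw [e] at key
    simp only [sub_neg_eq_add, timeDeriv_apply] at key
    have key2 : (2 * σ) • (f r + r • deriv f r) = 0 := by
      rw [← key, hf]
      module
    rcases smul_eq_zero.1 key2 with h0 | h0
    · exact absurd h0 (mul_ne_zero two_ne_zero hσ)
    · exact h0
  set F : ℝ → E3 := fun r => r • f r with hF
  have hFd : ∀ r < 0, HasDerivAt F 0 r := by
    intro r hr
    have h1 : HasDerivAt F (id r • deriv f r + (1 : ℝ) • f r) r :=
      (hasDerivAt_id r).fun_smul (hfd r hr).hasDerivAt
    simp only [id, one_smul] at h1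
    rwa [add_comm, hode r hr] at h1
  have hFconst : ∀ r < 0, F r = F t := by
    intro r hr
    exact IsOpen.is_const_of_deriv_eq_zero isOpen_Iio isPreconnected_Iio
      (fun r' hr' => (hFd r' hr').differentiableAt.differentiableWithinAt)
      (fun r' hr' => (hFd r' hr').deriv) hr ht
  have hbound : ∀ r < 0, ‖u t x‖ ≤ C * Real.sqrt (-r) / (-t) := by
    intro r hr
    have h1 : t • u t x = r • u r x := (hFconst r hr).symm
    have hsr : 0 < Real.sqrt (-r) := Real.sqrt_pos.2 (by linarith)
    have h2 : ‖u r x‖ ≤ C / Real.sqrt (-r) := hcl.norm_le hr x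
    have h3 : (-t) * ‖u t x‖ = (-r) * ‖u r x‖ := by
      have := congrArg (fun v => ‖v‖) h1
      simp only [norm_smul, Real.norm_eq_abs, abs_of_neg ht, abs_of_neg hr] at this
      exact this
    rw [le_div_iff₀ (by linarith : (0:ℝ) < -t), mul_comm, h3]
    calc (-r) * ‖u r x‖ ≤ (-r) * (C / Real.sqrt (-r)) := by gcongr; linarith
      _ = C * Real.sqrt (-r) := by
          rw [mul_div_assoc', div_eq_iff hsr.ne', mul_assoc, Real.mul_self_sqrt (by linarith)]
          ring
  by_contra hx
  have hn : 0 < ‖u t x‖ := norm_pos_iff.2 hx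
  set ε : ℝ := ‖u t x‖ * (-t) / (2 * (C + 1)) with hε
  have hε0 : 0 < ε := by
    rw [hε]
    exact div_pos (mul_pos hn (by linarith)) (by linarith)
  have h1 := hbound (-(ε ^ 2)) (by have := pow_pos hε0 2; linarith)
  rw [neg_neg, Real.sqrt_sq hε0.le] at h1
  have h2 : C * ε / (-t) < ‖u t x‖ := by
    rw [div_lt_iff₀ (by linarith : (0:ℝ) < -t), hε]
    have : C * (‖u t x‖ * -t / (2 * (C + 1))) = (C / (C + 1)) * (‖u t x‖ * -t) / 2 := by
      field_simp
    rw [this]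
    have hc1 : C / (C + 1) < 1 := (div_lt_one (by linarith)).2 (by linarith)
    have hpos : 0 < ‖u t x‖ * -t := mul_pos hn (by linarith)
    nlinarith
  linarith


end Summit.NavierStokesRegularity.NavierStokesRegularity.Theorems.SymmetricLiouville.Negative

end
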